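import Summits.ValiantsHypothesis.ValiantsHypothesis.Theorems.LacunarySymmetroidMatrixDescartesCensusTropicalKLaw

/-!
# Route «KPlusLogSqLaw» — the explicit `K = 3` tropical family SHIFT-THREE: definitions

HONEST FRAMING.  Definitions-only file (D-0009) of the helper chain toward the registered stub `stub_liftRungThree` of
the crux `Summit.ValiantsHypothesis.ValiantsHypothesis.Theses.KPlusLogSqLaw.Lifting` (ledger item
`stmt-ValiantsHypothesis-19772`, route `KPlusLogSqLaw`, object-search cell `pub-symmetroid`, seat val-sym-lift-p3,
2026-08-26).  It names ONE explicit tropical design per format `(m, 3)`, `m = n + 1 ≥ 1`, in the tree's dominance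
vocabulary (`tropWeight`, `termSign`, `IsDominant` of `MatrixDescartesFalseOfTropicalMonster.lean`), the grid of its
intended optima, and the bookkeeping functions of the proof; nothing is proved here (the companion files
`…TropicalShiftThree.lean` / `…TropicalShiftThreeChain.lean` prove that the design has `C(m+2,2) − 1` sign-alternating
unique optima, whence `TropicalCensus.TropRootLawAt m 3 B → C(m+2,2) − 2 ≤ B`).  These are concrete witnesses, not
notions: no statement of the route depends on them.  Nothing here asserts `Lifting`, `TropicalB`, `KPlusLogSqLaw`,
`MatrixDescartes` or anything about `VP ≠ VNP`.

THE DESIGN (a Lean-friendly variant of the cell's `K3_typeA` / ShiftThree family, conjb-2 g3 sketch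
`ShiftThreeSketch.lean`; replayed numerically there for `m ≤ 12`).  Nodes `Fin (n+1)`, classes `Fin 3`, exponents
`d = (0, 1, D)` with `D = m(2m+3)` (`dd`, `bigD`).  The entry in row `a = σ b` and column `b` has SHIFT
`q = a − b (mod m) ∈ [0, m)` (`shiftZ`) and WRAPS iff `a < b`.  Valuations (`vv`): every class pays the penalty
`pen q = (2m+3)(m+1)·q(q+1)`, class `1` additionally the price `L·q + 2(b+1)`, `L = 2(m+1)` (`price`).  Presence/signs
(`ee`): non-wrapping entries carry class `0` (`+1`) and class `1` (`−1`); wrapping entries carry class `2` only, with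
sign `+1` off the last column and, on the last column `b = n`, the sign `phaseSign (a+1) = (−1)^{T(a+1)}·sign σ_{a+1}`,
DEFINED through the sign of the one phase permutation that uses this entry (so the chain's signs need no cycle-type
computation).  Grid: phase `p < m`, step `a ≤ m − p`, slope `θ(p,a) = L·p + 2a + 1` (`th`), term
`cterm p a = (σ_p, λ_{p,a})` with `σ_p b = b + p (mod m)` (`rot`, an `Equiv.addRight`) and `λ_{p,a}` (`lam`) = class `2`
on the `p` wrapping columns `b ≥ m − p`, class `1` on the columns `b < a`, class `0` elsewhere; `T p = Σ_{p'<p}(m − p' + 1)`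
is the rank of `(p, 0)` in the lexicographic order, `step`/`grid` enumerate the grid, `phi` is the per-entry score after
the zero-sum redistribution `θ(2m+3)·shift − θ·D·[wrap]`, and `gval θ q = θ(2m+3)q − pen q` its shift part.
-/

set_option linter.dupNamespace false
set_option autoImplicit false

namespace Summit.ValiantsHypothesis.ValiantsHypothesis.Theorems.LacunarySymmetroidMatrixDescartes.TropicalCensus

open Summit.ValiantsHypothesis.ValiantsHypothesis.Theorems.MatrixDescartes.Negative
open scoped BigOperators
open Finset

namespace ShiftThree

variable (n : ℕ)

/-- the large exponent `D = m·(2m+3)` of class `2` (`m = n + 1`). -/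
def bigD : ℕ := (n + 1) * (2 * n + 5)

/-- exponents `d = (0, 1, D)`. -/
def dd : Fin 3 → ℕ := ![0, 1, bigD n]

/-- the integer SHIFT of the entry `(a, b)` (row `a = σ b`, column `b`): `a − b (mod m)` in `[0, m)`. -/
def shiftZ (a b : Fin (n + 1)) : ℤ :=
  if (a : ℕ) < (b : ℕ) then (a : ℤ) - b + (n + 1) else (a : ℤ) - b

/-- shift penalty `pen q = (2m+3)(m+1)·q(q+1)`. -/
def pen (q : ℤ) : ℤ := (2 * n + 5) * (n + 2) * (q * (q + 1))

/-- class-`1` price of the entry in column `b` with shift `q`: `L·q + 2(b+1)`, `L = 2(m+1)`. -/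
def price (q : ℤ) (b : Fin (n + 1)) : ℤ := (2 * n + 4) * q + 2 * ((b : ℤ) + 1)

/-- valuations: every class pays the shift penalty, class `1` additionally its price. -/
def vv : Fin (n + 1) → Fin (n + 1) → Fin 3 → ℤ := fun a b l =>
  pen n (shiftZ n a b) + if l = 1 then price n (shiftZ n a b) b else 0

/-- the row permutation of phase `p`: `σ_p b = b + p (mod m)`. -/
def rot (p : ℕ) : Equiv.Perm (Fin (n + 1)) :=
  Equiv.addRight (⟨p % (n + 1), Nat.mod_lt _ (Nat.succ_pos n)⟩ : Fin (n + 1))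

/-- rank of the grid point `(p, 0)`: `T p = Σ_{p' < p} (m − p' + 1)`. -/
def T : ℕ → ℕ
  | 0 => 0
  | p + 1 => T p + (n + 1 - p + 1)

/-- the sign carried into phase `p` by its last-column wrapping entry: `(−1)^{T p} · sign σ_p`. -/
def phaseSign (p : ℕ) : ℤ := (-1) ^ T n p * (Equiv.Perm.sign (rot n p) : ℤ)

/-- presence/sign pattern: a non-wrapping entry (`a ≥ b`) carries class `0` with `+1` and class `1` with `−1`;
a wrapping entry (`a < b`) carries class `2` only, with sign `+1` off the last column and `phaseSign (a+1)` on it. -/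
def ee : Fin (n + 1) → Fin (n + 1) → Fin 3 → ℤ := fun a b l =>
  if (a : ℕ) < (b : ℕ) then
    (if l = 2 then (if (b : ℕ) = n then phaseSign n ((a : ℕ) + 1) else 1) else 0)
  else (if l = 0 then 1 else if l = 1 then -1 else 0)

/-- the slope grid: phase `p`, step `a` ↦ `θ = L·p + 2a + 1`. -/
def th (p a : ℕ) : ℤ := (2 * n + 4) * p + 2 * a + 1

/-- the class map of the grid point `(p, a)`: wrapping columns (`b + p ≥ m`) take class `2`, columns `b < a`
class `1`, the rest class `0`. -/
def lam (p a : ℕ) : Fin (n + 1) → Fin 3 := fun b =>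
  if n + 1 ≤ (b : ℕ) + p then 2 else if (b : ℕ) < a then 1 else 0

/-- the Leibniz term of the grid point `(p, a)`. -/
def cterm (p a : ℕ) : Equiv.Perm (Fin (n + 1)) × (Fin (n + 1) → Fin 3) := (rot n p, lam n p a)

/-- per-entry score at slope `θ`, corrected by the zero-sum redistribution `θ·(2m+3)·shift − θ·D·[wrap]`. -/
def phi (θ : ℤ) (a b : Fin (n + 1)) (l : Fin 3) : ℤ :=
  θ * (dd n l : ℤ) - vv n a b l + θ * (2 * n + 5) * shiftZ n a b -
    θ * (bigD n : ℤ) * (if (a : ℕ) < (b : ℕ) then 1 else 0)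

/-- the shift part of the score: `g_θ(q) = θ(2m+3)q − pen q`. -/
def gval (θ q : ℤ) : ℤ := θ * (2 * n + 5) * q - pen n q

/-- successor on the grid: `(p, a) ↦ (p, a + 1)` while `a + p < m`, else `(p + 1, 0)`. -/
def step (x : ℕ × ℕ) : ℕ × ℕ := if x.2 + x.1 < n + 1 then (x.1, x.2 + 1) else (x.1 + 1, 0)

/-- the `k`-th grid point `(p_k, a_k)`. -/
def grid (k : ℕ) : ℕ × ℕ := (step n)^[k] (0, 0)

end ShiftThree

end Summit.ValiantsHypothesis.ValiantsHypothesis.Theorems.LacunarySymmetroidMatrixDescartes.TropicalCensus
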